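import Summits.ResolutionOfSingularities.ResolutionOfSingularities.Theorems.HilbertSamuelEliminationSigmaMaxModificationsCorridor3WLadderIsoProximityDefs
import Mathlib.RingTheory.MvPolynomial.Basic
import Mathlib.Algebra.MvPolynomial.Monad
import Mathlib.RingTheory.MvPowerSeries.Substitution
import Mathlib.RingTheory.Ideal.Operations
import HarnessLib

/-!
# [OURS · L1 W4.2 · D14 «K1 FREE-RATIONAL TAILS»] The ARC-DIVISIBILITY lemma of card C5 §1, PROVED in both strengths,
# and the strict-transform recursion along the `t`-axis (crux `SigmaMaxModifications` stmt-ResolutionOfSingularities-18506 /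
# conjunct `SigmaMaxModificationsCorridor3` stmt-…-19249; line `w_ladder` v7 `w_ladder_local`; kernel `IsoQuadraticTowerTerminates p 3`
# of `stub_Wtop3M_pointed`, incidence partition K1 ⊔ K2 ⊔ K3 of res-L1-w42-idea-1's card C5)

Lead prover res-L1-w42-lead-1 (gen 4), deal D14 of res-L1-w42-plan-1 RULINGS v3.12-3 (O). Helper file
`--supports stmt-ResolutionOfSingularities-19249 --as helper`; kernel only — no definition of record, no named fact; the two
statements `ArcDivisibilityPoly` / `ArcDivisibilitySeries` and the substitutions `chartSubst` / `chartSubstSeries` are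
res-type-012's Defs pass of idea-1's Sketch C5 (`…Corridor3WLadderIsoProximityDefs`), consumed BY NAME.

OURS (cell res-hironaka, slot W4.2); NOT statements of H. Hironaka's manuscript [Hironaka2017] nor of [CossartJannsenSaito2020] /
[CossartPiltant2009]. AI-written; AI review is weaker than expert review.

## What is proved (every commutative ring `K`, every `m`)

* `arcDivisibilityPoly_holds (K) (m) : ArcDivisibilityPoly K m` — in `K[t, y₁, y₂, y₃]`: if `t^{n m} ∣ h(t, tⁿ y)` for every `n`, then
  `h ∈ (y₁, y₂, y₃)^m`.
* `arcDivisibilitySeries_holds (K) (m) : ArcDivisibilitySeries K m` — the same in `K⟦t, y₁, y₂, y₃⟧` (Mathlib `MvPowerSeries.subst`).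
* `Series.subst_chartSubstSeries_eq_of_strictTransforms` — THE STRICT-TRANSFORM RECURSION: if `g 0 = h` and
  `g_j(t, t y) = t^m · g_{j+1}(t, y)` for every `j` (each `g_{j+1}` is the strict transform of `g_j` at the origin of the `t`-chart, for
  multiplicity `m`), then `h(t, tⁿ y) = t^{n m} · g_n(t, y)`; hence (`…X_pow_dvd…_of_strictTransforms`) the hypothesis of
  `ArcDivisibilitySeries`, and `Series.mem_pow_of_strictTransforms : h ∈ (y₁, y₂, y₃)^m` — «multiplicity `m` at ALL infinitely near points
  of the arc `{y = 0}` forces the arc into the multiplicity-`m` locus».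
* the closed coefficient formula `Series.coeff_subst_chartSubstSeries` (the `n`-th substitution sends `t^a y^b ↦ t^{a + n|b|} y^b`
  injectively on exponents) and `Series.X_pow_dvd_subst_chartSubstSeries_one` (a series of order `≥ m` has first total transform
  divisible by `t^m`, so its strict transform exists).

MECHANISM (both strengths): a monomial `t^a y^b` with `|b| < m` survives the `n`-th substitution as `t^{a + n|b|} y^b`; divisibility by
`t^{n m}` then needs `a ≥ n (m − |b|) ≥ n`, absurd for `n = a + 1`; so every monomial of `h` has `|b| ≥ m` — for polynomials this is
membership in `(y)^m` monomial by monomial, for series by the decomposition `h = y₁ h₁ + y₂ h₂ + y₃ h₃` (least `y`-variable) and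
induction on `m`.

ROLE IN K1 (`IsoFreeRationalTailsImpossible p 3`): an eventually free-rational tail of an isolated point tower is the sequence of
infinitely near points of one regular formal arc; straightened to `{y = 0}` in a power-series presentation of the completed regular
ambient (hypersurface case, `edim = 4`), constancy of the Hilbert–Samuel function = constancy of the multiplicity `m` of the strict
transforms `g_j`, i.e. the recursion above; the conclusion `h ∈ (y)^m` puts the arc inside the multiplicity-`m` locus of `Spec 𝒪̂`,
against isolation (excellence). Those bridge steps are separate objects (lead-1 PACE D14 #1, 2026-08-27).

References: idea-1 card C5 «proximity trichotomy + arc osculation» (Sketch d9de4647629be5a3); V. Cossart, O. Piltant, J. Algebra 321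
(2009) ch. 3 I.9 (formal curve in `Σ_p`) [CossartPiltant2009]; V. Cossart, U. Jannsen, S. Saito, LNM 2270 (2020), proof of Lemma 11.5
(the pattern `v_𝔭(f_j) ≥ n_j ⇒ Thm. 3.2 (2)(iv), Thm. 3.3`) [CossartJannsenSaito2020].
-/

noncomputable section

set_option linter.dupNamespace false -- mandated namespace of this single-conjunct summit

namespace Summit.ResolutionOfSingularities.ResolutionOfSingularities.Cruxes.SigmaMaxModifications.IdeasL1C5

universe u

/-! ## §0. Exponent bookkeeping common to both strengths -/

namespace ArcDiv

/-- The `y`-degree `|b| = s 1 + s 2 + s 3` of an exponent `s` of `K[t, y₁, y₂, y₃]` / `K⟦t, y₁, y₂, y₃⟧` (index `0` = `t`). [folklore] -/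
def yDeg (s : Fin 4 →₀ ℕ) : ℕ := s 1 + s 2 + s 3

/-- The exponent shift of the `n`-th chart substitution: `t^a y^b ↦ t^{a + n|b|} y^b`. [folklore] -/
def shift (n : ℕ) (s : Fin 4 →₀ ℕ) : Fin 4 →₀ ℕ := s + Finsupp.single 0 (n * yDeg s)

/-- The `t`-exponent after the shift. [folklore] -/
theorem shift_apply_zero (n : ℕ) (s : Fin 4 →₀ ℕ) : shift n s 0 = s 0 + n * yDeg s := by
  simp [shift]

/-- The `y`-exponents are unchanged by the shift. [folklore] -/
theorem shift_apply_of_ne_zero (n : ℕ) (s : Fin 4 →₀ ℕ) {i : Fin 4} (hi : i ≠ 0) : shift n s i = s i := by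
  simp [shift, hi.symm]

/-- The `y`-degree is unchanged by the shift. [folklore] -/
theorem yDeg_shift (n : ℕ) (s : Fin 4 →₀ ℕ) : yDeg (shift n s) = yDeg s := by
  simp only [yDeg]
  rw [shift_apply_of_ne_zero n s (by decide), shift_apply_of_ne_zero n s (by decide),
    shift_apply_of_ne_zero n s (by decide)]

/-- The shift is injective on exponents (the `y`-part is kept, and it determines the `t`-shift). [folklore] -/
theorem shift_injective (n : ℕ) : Function.Injective (shift n) := by
  intro s u h
  have hy : ∀ i : Fin 4, i ≠ 0 → s i = u i := fun i hi => by
    rw [← shift_apply_of_ne_zero n s hi, ← shift_apply_of_ne_zero n u hi, h]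
  have hdeg : yDeg s = yDeg u := by
    simp only [yDeg]; rw [hy 1 (by decide), hy 2 (by decide), hy 3 (by decide)]
  ext i
  by_cases hi : i = 0
  · subst hi
    have h0 := congrArg (fun f => f 0) h
    simp only [shift_apply_zero] at h0
    rw [hdeg] at h0
    omega
  · exact hy i hi

/-- An exponent `e` with `n|b| ≤ e 0` is the shift of `e − n|b|·ε₀`. [folklore] -/
theorem shift_sub_eq {n : ℕ} {e : Fin 4 →₀ ℕ} (he : n * yDeg e ≤ e 0) :
    shift n (e - Finsupp.single 0 (n * yDeg e)) = e := by
  have hy : yDeg (e - Finsupp.single 0 (n * yDeg e)) = yDeg e := by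
    simp [yDeg]
  ext i
  by_cases hi : i = 0
  · subst hi; rw [shift_apply_zero, hy]; simp; omega
  · rw [shift_apply_of_ne_zero n _ hi]; simp [Ne.symm hi]

end ArcDiv

/-! ## §1. Polynomial strength -/

namespace Poly

open MvPolynomial ArcDiv

variable {K : Type u} [CommRing K]

/-- The chart substitution on a monomial: `t^a y^b ↦ t^{a + n|b|} y^b`. [folklore] -/
theorem bind₁_chartSubst_monomial (n : ℕ) (s : Fin 4 →₀ ℕ) (c : K) :
    bind₁ (chartSubst K n) (monomial s c) = monomial (shift n s) c := by
  rw [bind₁_monomial, monomial_eq, Finsupp.prod_fintype _ _ (fun i => by simp)]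
  have hsub : ∏ i ∈ s.support, chartSubst K n i ^ s i = ∏ i, chartSubst K n i ^ s i :=
    Finset.prod_subset (Finset.subset_univ _) fun i _ hi => by
      rw [Finsupp.notMem_support_iff.mp hi, pow_zero]
  rw [hsub]
  simp only [Fin.prod_univ_four, chartSubst, Fin.isValue, ↓reduceIte, one_ne_zero,
    show (2 : Fin 4) ≠ 0 by decide, show (3 : Fin 4) ≠ 0 by decide]
  rw [shift_apply_zero, shift_apply_of_ne_zero n s (by decide : (1 : Fin 4) ≠ 0),
    shift_apply_of_ne_zero n s (by decide : (2 : Fin 4) ≠ 0),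
    shift_apply_of_ne_zero n s (by decide : (3 : Fin 4) ≠ 0), yDeg]
  ring

/-- Coefficient extraction: the coefficient of `t^{a + n|b|} y^b` in `h(t, tⁿ y)` is the coefficient of `t^a y^b` in `h`. [folklore] -/
theorem coeff_shift_bind₁_chartSubst (n : ℕ) (h : MvPolynomial (Fin 4) K) (s : Fin 4 →₀ ℕ) :
    coeff (shift n s) (bind₁ (chartSubst K n) h) = coeff s h := by
  conv_lhs => rw [h.as_sum, map_sum]
  simp_rw [bind₁_chartSubst_monomial, coeff_sum, coeff_monomial]
  rw [Finset.sum_eq_single s]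
  · simp
  · intro u _ hus
    rw [if_neg]
    exact fun h' => hus (shift_injective n h')
  · intro hs
    rw [if_pos rfl]
    simpa [mem_support_iff] using hs

/-- Divisibility by `t^k` bounds the `t`-exponents of the support from below. [folklore] -/
theorem le_of_X_pow_dvd {k : ℕ} {g : MvPolynomial (Fin 4) K} (hdvd : X 0 ^ k ∣ g) {e : Fin 4 →₀ ℕ}
    (he : coeff e g ≠ 0) : k ≤ e 0 := by
  obtain ⟨q, rfl⟩ := hdvd
  rw [X_pow_eq_monomial, coeff_monomial_mul'] at he
  by_contra hk
  apply he
  rw [if_neg]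
  intro hle
  exact hk (by simpa using hle 0)

/-- A monomial of `y`-degree `≥ m` lies in `(y₁, y₂, y₃)^m`. [folklore] -/
theorem monomial_mem_pow_of_le (m : ℕ) (s : Fin 4 →₀ ℕ) (c : K) (hs : m ≤ yDeg s) :
    monomial s c ∈ (Ideal.span ({X 1, X 2, X 3} : Set (MvPolynomial (Fin 4) K))) ^ m := by
  set I : Ideal (MvPolynomial (Fin 4) K) := Ideal.span {X 1, X 2, X 3} with hI
  have h1 : (X 1 : MvPolynomial (Fin 4) K) ∈ I := Ideal.subset_span (by simp)
  have h2 : (X 2 : MvPolynomial (Fin 4) K) ∈ I := Ideal.subset_span (by simp)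
  have h3 : (X 3 : MvPolynomial (Fin 4) K) ∈ I := Ideal.subset_span (by simp)
  have hprod : (X 1 ^ s 1 * X 2 ^ s 2 * X 3 ^ s 3 : MvPolynomial (Fin 4) K) ∈ I ^ yDeg s := by
    rw [yDeg, pow_add, pow_add]
    exact Ideal.mul_mem_mul (Ideal.mul_mem_mul (Ideal.pow_mem_pow h1 _) (Ideal.pow_mem_pow h2 _))
      (Ideal.pow_mem_pow h3 _)
  have hmon : monomial s c = C c * X 0 ^ s 0 * (X 1 ^ s 1 * X 2 ^ s 2 * X 3 ^ s 3) := by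
    rw [monomial_eq, Finsupp.prod_fintype _ _ (fun i => by simp)]
    simp only [Fin.prod_univ_four]
    ring
  rw [hmon]
  exact Ideal.mul_mem_left _ _ (Ideal.pow_le_pow_right hs hprod)

end Poly

/-- **[OURS · L1 W4.2 · D14 / card C5 §1] ARC DIVISIBILITY, polynomial strength — PROVED for every commutative ring `K` and every `m`:**
if `t^{n m} ∣ h(t, tⁿ y₁, tⁿ y₂, tⁿ y₃)` for every `n`, then `h ∈ (y₁, y₂, y₃)^m`.
[cite: CossartPiltant2009, ch. 3 I.9] -/
theorem arcDivisibilityPoly_holds (K : Type u) [CommRing K] (m : ℕ) : ArcDivisibilityPoly K m := by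
  intro h hdiv
  rw [h.as_sum]
  refine Submodule.sum_mem _ fun s hs => Poly.monomial_mem_pow_of_le m s _ ?_
  -- the monomial `t^{s 0} y^b`, `|b| = yDeg s`, survives every substitution with `t`-exponent `s 0 + n |b|`
  by_contra hlt
  push Not at hlt
  have hc : MvPolynomial.coeff s h ≠ 0 := by simpa [MvPolynomial.mem_support_iff] using hs
  have key := Poly.le_of_X_pow_dvd (hdiv (s 0 + 1)) (e := ArcDiv.shift (s 0 + 1) s)
    (by rwa [Poly.coeff_shift_bind₁_chartSubst])
  rw [ArcDiv.shift_apply_zero] at key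
  have : (s 0 + 1) * (ArcDiv.yDeg s + 1) ≤ (s 0 + 1) * m := Nat.mul_le_mul_left _ hlt
  nlinarith

/-! ## §2. Formal strength -/

namespace Series

open MvPowerSeries ArcDiv

variable {K : Type u} [CommRing K]

/-- The chart family has zero constant coefficients, so it can be substituted. [folklore] -/
theorem hasSubst_chartSubstSeries (n : ℕ) : HasSubst (chartSubstSeries K n) :=
  hasSubst_of_constantCoeff_zero fun i => by
    unfold chartSubstSeries
    split_ifs <;> simp

/-- `t ↦ t`. [folklore] -/
theorem chartSubstSeries_apply_zero (n : ℕ) : chartSubstSeries K n 0 = X 0 := by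
  simp [chartSubstSeries]

/-- `y_i ↦ tⁿ y_i`. [folklore] -/
theorem chartSubstSeries_apply_of_ne (n : ℕ) {i : Fin 4} (hi : i ≠ 0) :
    chartSubstSeries K n i = X 0 ^ n * X i := by
  simp [chartSubstSeries, hi]

/-- The product `∏ (a i)^{s i}` for the chart family is the monomial `t^{s 0 + n|b|} y^b`. [folklore] -/
theorem prod_chartSubstSeries_pow (n : ℕ) (s : Fin 4 →₀ ℕ) :
    (s.prod fun i k => chartSubstSeries K n i ^ k) = monomial (shift n s) (1 : K) := by
  rw [Finsupp.prod_fintype _ _ (fun i => by simp)]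
  simp only [Fin.prod_univ_four, chartSubstSeries, Fin.isValue, ↓reduceIte, one_ne_zero,
    show (2 : Fin 4) ≠ 0 by decide, show (3 : Fin 4) ≠ 0 by decide]
  have hX : ∀ (i : Fin 4) (k : ℕ), (X i : MvPowerSeries (Fin 4) K) ^ k = monomial (Finsupp.single i k) 1 :=
    fun i k => X_pow_eq i k
  rw [mul_pow, mul_pow, mul_pow, ← pow_mul, ← pow_mul, ← pow_mul]
  simp only [hX, monomial_mul_monomial, one_mul]
  refine congrArg (fun e => monomial e (1 : K)) ?_
  ext i
  fin_cases i <;> simp [shift, yDeg]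
  ring

/-- **Closed formula for the coefficients of the `n`-th total transform**: the coefficient of `t^a y^b` in `h(t, tⁿ y)` is the
coefficient of `t^{a − n|b|} y^b` in `h` if `n|b| ≤ a`, and `0` otherwise. [folklore] -/
theorem coeff_subst_chartSubstSeries (n : ℕ) (g : MvPowerSeries (Fin 4) K) (e : Fin 4 →₀ ℕ) :
    coeff e (subst (chartSubstSeries K n) g) =
      if n * yDeg e ≤ e 0 then coeff (e - Finsupp.single 0 (n * yDeg e)) g else 0 := by
  rw [coeff_subst (hasSubst_chartSubstSeries n)]
  simp_rw [prod_chartSubstSeries_pow, coeff_monomial]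
  split_ifs with hle
  · rw [finsum_eq_single _ (e - Finsupp.single 0 (n * yDeg e))]
    · rw [if_pos (shift_sub_eq hle).symm]; simp
    · intro d hd
      rw [if_neg]
      · simp
      · intro hed
        apply hd
        apply shift_injective n
        rw [shift_sub_eq hle, hed]
  · rw [finsum_eq_zero_of_forall_eq_zero]
    intro d
    rw [if_neg]
    · simp
    · intro hed
      apply hle
      rw [hed, shift_apply_zero, yDeg_shift]
      omega

/-- Coefficient extraction at a shifted exponent. [folklore] -/
theorem coeff_shift_subst (n : ℕ) (h : MvPowerSeries (Fin 4) K) (s : Fin 4 →₀ ℕ) :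
    coeff (shift n s) (subst (chartSubstSeries K n) h) = coeff s h := by
  rw [coeff_subst_chartSubstSeries]
  have hle : n * yDeg (shift n s) ≤ shift n s 0 := by rw [yDeg_shift, shift_apply_zero]; omega
  rw [if_pos hle]
  have hs : shift n s - Finsupp.single 0 (n * yDeg (shift n s)) = s :=
    shift_injective n (by rw [shift_sub_eq hle])
  rw [hs]

/-- An exponent in the support of `h` has `y`-degree `≥ m` under the arc-divisibility hypothesis. [folklore] -/
theorem le_yDeg_of_dvd {m : ℕ} {h : MvPowerSeries (Fin 4) K}
    (hdiv : ∀ n : ℕ, X 0 ^ (n * m) ∣ subst (chartSubstSeries K n) h) {s : Fin 4 →₀ ℕ} (hs : coeff s h ≠ 0) :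
    m ≤ yDeg s := by
  by_contra hlt
  push Not at hlt
  have key := (X_pow_dvd_iff.mp (hdiv (s 0 + 1))) (shift (s 0 + 1) s)
  rw [coeff_shift_subst, shift_apply_zero] at key
  have : (s 0 + 1) * (yDeg s + 1) ≤ (s 0 + 1) * m := Nat.mul_le_mul_left _ hlt
  exact hs (key (by nlinarith))

/-- The ideal `(y₁, y₂, y₃) ⊂ K⟦t, y₁, y₂, y₃⟧` (the ideal of the arc `{y = 0}`). [folklore] -/
def J (K : Type u) [CommRing K] : Ideal (MvPowerSeries (Fin 4) K) :=
  Ideal.span {MvPowerSeries.X 1, MvPowerSeries.X 2, MvPowerSeries.X 3}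

/-- The `y`-variables lie in `J`. [folklore] -/
theorem X_mem_J {i : Fin 4} (hi : i ≠ 0) : (X i : MvPowerSeries (Fin 4) K) ∈ J K := by
  apply Ideal.subset_span
  fin_cases i <;> simp_all

/-- The `y`-variable to which a monomial of positive `y`-degree is assigned (the least one present). [folklore] -/
def pick (e : Fin 4 →₀ ℕ) : Fin 4 := if e 1 ≠ 0 then 1 else if e 2 ≠ 0 then 2 else 3

/-- `pick e` is a `y`-variable. [folklore] -/
theorem pick_ne_zero (e : Fin 4 →₀ ℕ) : pick e ≠ 0 := by
  unfold pick; split_ifs <;> decide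

/-- `pick e` occurs in `e` when `|b| > 0`. [folklore] -/
theorem pick_pos {e : Fin 4 →₀ ℕ} (he : 0 < yDeg e) : 0 < e (pick e) := by
  unfold pick
  split_ifs with h1 h2
  · exact Nat.pos_of_ne_zero h1
  · exact Nat.pos_of_ne_zero h2
  · simp only [yDeg, not_not] at *; omega

/-- The `i`-th partial quotient: the monomials of `h` assigned to the variable `y_i`, divided by `y_i`. [folklore] -/
def part (h : MvPowerSeries (Fin 4) K) (i : Fin 4) : MvPowerSeries (Fin 4) K :=
  fun e' => if pick (e' + Finsupp.single i 1) = i then coeff (e' + Finsupp.single i 1) h else 0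

/-- Unfolding the coefficients of `part`. [folklore] -/
theorem coeff_part (h : MvPowerSeries (Fin 4) K) (i : Fin 4) (e' : Fin 4 →₀ ℕ) :
    coeff e' (part h i) = if pick (e' + Finsupp.single i 1) = i then coeff (e' + Finsupp.single i 1) h else 0 :=
  rfl

/-- The coefficients of `y_i · part h i`. [folklore] -/
theorem coeff_X_mul_part (h : MvPowerSeries (Fin 4) K) (i : Fin 4) (e : Fin 4 →₀ ℕ) :
    coeff e (X i * part h i) = if 0 < e i ∧ pick e = i then coeff e h else 0 := by
  have hX1 : (X i : MvPowerSeries (Fin 4) K) = monomial (Finsupp.single i 1) 1 := by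
    rw [← X_pow_eq i 1, pow_one]
  rw [hX1, coeff_monomial_mul, one_mul, coeff_part]
  by_cases hi : 0 < e i
  · have hle : Finsupp.single i 1 ≤ e := by
      rw [Finsupp.single_le_iff]; exact hi
    have hsub : e - Finsupp.single i 1 + Finsupp.single i 1 = e := tsub_add_cancel_of_le hle
    rw [if_pos hle, hsub]
    by_cases hp : pick e = i
    · rw [if_pos hp, if_pos ⟨hi, hp⟩]
    · rw [if_neg hp, if_neg (fun h' => hp h'.2)]
  · have hle : ¬ Finsupp.single i 1 ≤ e := by
      rw [Finsupp.single_le_iff]; omega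
    rw [if_neg hle, if_neg (fun h' => hi h'.1)]

/-- **The decomposition `h = y₁ h₁ + y₂ h₂ + y₃ h₃`** for a series without `y`-free monomials. [folklore] -/
theorem eq_sum_X_mul_part (h : MvPowerSeries (Fin 4) K) (H : ∀ e, coeff e h ≠ 0 → 0 < yDeg e) :
    h = X 1 * part h 1 + X 2 * part h 2 + X 3 * part h 3 := by
  ext e
  simp only [map_add, coeff_X_mul_part]
  by_cases he : 0 < yDeg e
  · have hp := pick_pos he
    have h1 : (pick e = 1) ∨ (pick e = 2) ∨ (pick e = 3) := by
      unfold pick; split_ifs <;> simp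
    rcases h1 with h1 | h2 | h3
    · rw [h1] at hp; simp [h1, hp]
    · rw [h2] at hp; simp [h2, hp]
    · rw [h3] at hp; simp [h3, hp]
  · have h0 : coeff e h = 0 := by
      by_contra hne; exact he (H e hne)
    have : ¬ (0 < e 1) ∧ ¬ (0 < e 2) ∧ ¬ (0 < e 3) := by
      simp only [yDeg] at he; omega
    simp [h0, this.1, this.2.1, this.2.2]

/-- **A series all of whose monomials have `y`-degree `≥ m` lies in `(y₁, y₂, y₃)^m`** (induction on `m` through the decomposition).
[folklore] -/
theorem mem_J_pow_of_forall_coeff (m : ℕ) :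
    ∀ h : MvPowerSeries (Fin 4) K, (∀ e, coeff e h ≠ 0 → m ≤ yDeg e) → h ∈ J K ^ m := by
  induction m with
  | zero => intro h _; simp
  | succ m ih =>
    intro h H
    have Hpos : ∀ e, coeff e h ≠ 0 → 0 < yDeg e := fun e he => by have := H e he; omega
    have hpart : ∀ i : Fin 4, i ≠ 0 → part h i ∈ J K ^ m := fun i hi => by
      refine ih _ fun e' he' => ?_
      rw [coeff_part] at he'
      split_ifs at he' with hp
      · have := H _ he'
        simp only [yDeg, Finsupp.coe_add, Pi.add_apply, Finsupp.single_apply] at this ⊢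
        fin_cases i <;> simp_all <;> omega
      · exact absurd rfl he'
    have hmul : ∀ i : Fin 4, i ≠ 0 → X i * part h i ∈ J K ^ (m + 1) := fun i hi => by
      rw [pow_succ']
      exact Ideal.mul_mem_mul (X_mem_J hi) (hpart i hi)
    rw [eq_sum_X_mul_part h Hpos]
    exact Ideal.add_mem _ (Ideal.add_mem _ (hmul 1 (by decide)) (hmul 2 (by decide))) (hmul 3 (by decide))

end Series

/-- **[OURS · L1 W4.2 · D14 / card C5 §1] ARC DIVISIBILITY, formal strength — PROVED for every commutative ring `K` and every `m`:**
in `K⟦t, y₁, y₂, y₃⟧`, if `t^{n m} ∣ h(t, tⁿ y)` for every `n`, then `h ∈ (y₁, y₂, y₃)^m`. [cite: CossartPiltant2009, ch. 3 I.9] -/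
theorem arcDivisibilitySeries_holds (K : Type u) [CommRing K] (m : ℕ) : ArcDivisibilitySeries K m := by
  intro h hdiv
  exact Series.mem_J_pow_of_forall_coeff m h fun e he => Series.le_yDeg_of_dvd hdiv he

end Summit.ResolutionOfSingularities.ResolutionOfSingularities.Cruxes.SigmaMaxModifications.IdeasL1C5

end
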